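/-
Origin: expansion seat `planner-pub-hodgecm-pv01-0`, handover 2026-08-18T03:30:56Z (`HOME/pub-hodgecm-pv01/lean/Pv01/N33eCores.lean`, md5 09a8e743, 83 lines);
landed by the gen-5 packager in gate run 18 as `HodgeCM/PerL34/N33eCores.lean` (import renamed; DEDUP as the seat asked: the two copied `def`s
`N33e_core_noInvariantLine` / `N33e_core_minors` (10+9 lines) deleted and `import HodgeCM.PerL34.Wedge` (the carver's originals) added).
-/
/-
Origin: HOME/pub-hodgecm-pv01/lean/Pv01/N33eCores.lean — session planner-pub-hodgecm-pv01-0 (unit pub-hodgecm-pv01,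
DAG-NODE PROVER #01).  Intended final place: `HodgeCM/PerL34/N33eCores.lean` (or appended to `HodgeCM/PerL34/Wedge.lean`).
DAG node (HOME/LEMMAS.md v2 §1): N33e — the two finite-dimensional CORES typed by the carver in
`Carver/PerL34/Wedge.lean` (`N33e_core_noInvariantLine`, `N33e_core_minors`), PROVED here.  The two `def`s are copied
VERBATIM from the carver's file (LEMMAS.md §4 option (i): same name, same namespace; the packager dedups at landing by
deleting the copies below and importing `HodgeCM.PerL34.Wedge`).
-/
import Summits.HodgeConjecture.HodgeCM.PerL34.LineField
import Summits.HodgeConjecture.HodgeCM.PerL34.Wedge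

set_option autoImplicit false

/-!
# N33e — the carver's finite-dimensional cores, proved

* `N33e_core_noInvariantLine_holds` : no line of `ℂ²` is invariant under every unitary matrix
  (PerL v5 Prop. 4.3 proof, tex ll. 677–680; from `LineField.exists_SU2_moves_line`, explicit `SU(2)` witnesses).
* `N33e_core_minors_holds` : vectors all proportional to one non-zero vector span a space of rank `≤ 1`
  (tex ll. 668–671).

Both statements are the carver's (copied verbatim, see the header); nothing is assumed.
-/

noncomputable section

namespace HodgeCM
namespace PerL34

/-- **N33e core (i) holds**: for a line `ℓ = ℂ ∙ v` take the `SU(2)` element `g` of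
`LineField.exists_SU2_moves_line` with `g v, v` linearly independent; then `g v ∉ ℓ`. -/
theorem N33e_core_noInvariantLine_holds : N33e_core_noInvariantLine := by
  intro ℓ hℓ
  obtain ⟨v, hv, hgen⟩ := finrank_eq_one_iff'.mp hℓ
  have hv₀ : (v : Fin 2 → ℂ) ≠ 0 := fun h => hv (Subtype.ext h)
  obtain ⟨g, hg, hli⟩ := LineField.exists_SU2_moves_line (v : Fin 2 → ℂ) hv₀ 1 one_ne_zero
  rw [one_smul] at hli
  have hgU : g ∈ Matrix.unitaryGroup (Fin 2) ℂ := (Matrix.mem_specialUnitaryGroup_iff.mp hg).1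
  refine ⟨⟨g, hgU⟩, fun hle => ?_⟩
  have hmem : g.mulVec (v : Fin 2 → ℂ) ∈ ℓ := by
    have := hle (Submodule.mem_map_of_mem (f := Matrix.toLin' g) v.2)
    simpa [Matrix.toLin'_apply] using this
  obtain ⟨c, hc⟩ := hgen ⟨_, hmem⟩
  have hc' : c • (v : Fin 2 → ℂ) = g.mulVec (v : Fin 2 → ℂ) := by
    simpa using congrArg Subtype.val hc
  rw [LinearIndependent.pair_iff] at hli
  have h10 := hli 1 (-c) (by rw [one_smul, neg_smul, ← hc', add_neg_cancel])
  exact one_ne_zero h10.1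

/-- **N33e core (ii) holds**: the span of vectors proportional to `u ≠ 0` lies in the line `ℂ ∙ u`. -/
theorem N33e_core_minors_holds : N33e_core_minors := by
  intro u hu S hS
  have hle : Submodule.span ℂ S ≤ (ℂ ∙ u) := by
    rw [Submodule.span_le]
    intro v hv
    obtain ⟨a, rfl⟩ := hS v hv
    exact Submodule.smul_mem _ a (Submodule.mem_span_singleton_self u)
  calc Module.finrank ℂ (Submodule.span ℂ S)
      ≤ Module.finrank ℂ (ℂ ∙ u) := Submodule.finrank_mono hle
    _ = 1 := finrank_span_singleton hu

end PerL34
end HodgeCM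

end
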